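import Literature.MathematicalPhysics.QuantumFieldTheory.Balaban1983to89.HaarAnalyticZeroSetNull

/-!
# `Balaban1983to89.HaarAnalyticZeroSetNullLocal` — THE OPEN-SET (LOCAL) EDITION of the proof principle of
# [BrockerTomDieck1985] IV (2.11) «every chart of the manifold G maps the set … to a set of measure zero in ℝⁿ»: for a
# compact group `G` faithfully represented on a log-charted linear group (every closed `G ≤ U(N)`, `U(N)`, `SU(N)`),
# EVERY Haar measure `μ`, and `f` REAL-ANALYTIC ONLY ON AN OPEN `W` of the ambient algebra, the zero set of `f` on
# `G ∩ W` is `μ`-null up to its (relatively open) FLAT LOCUS, and `μ`-null outright on every preconnected piece of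
# `G ∩ W` carrying one non-zero of `f`

statement-level skeleton of published theorems with citation tags; proofs where landed; nothing here is a claim
about the Yang–Mills mass gap

Cell `pub-ymgap` (YM-PLAN Track A), node N09 [B12] width seat `pub-ymgap-dag-n09-w3` (g4), `--supports` K1⁷
`StabilityBAtRecordR13SepCoPH` = stmt-QuantumFields-20542 as a count-neutral helper.  RIDER to lit-balaban p28's
`HaarAnalyticZeroSetNull` ([BtD] IV (2.11) file 6: every closed `G ≤ U(N)` with `Θ_G` onto, `f : M_N(ℂ) → ℂ`
real-analytic on ALL of `M_N(ℂ)`; HONEST SCOPE (i) there: «analytic only near `G` is not covered» — the same line (i)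
in dag-n09-w2's several-variables riders `HaarAnalyticZeroSetNullPi` ∕ `FieldMeasureAnalyticZeroSetNull`).  THIS FILE
removes that restriction: `f` need only be real-analytic on an OPEN `W` (principal logarithms, implicit functions, local
minimisers composed with analytic functionals), at the price the identity theorem always asks — subtract the FLAT
LOCUS `{g : f ∘ ρ ≡ 0 near g}` (then NO surjectivity of `Θ` and NO connectedness is needed), or work on a preconnected
piece of `G ∩ W` with one non-zero.  LOCATED CONSUMER (pub-ymgap NODE 00 ∕ N09; dag-n09-w3 g3 `HANDOFF.md` §g3.3 ∕
trigger (t2); header of `Summits/…/BalabanUVNodesN09ContourThresholdNull`): the (2.17) threshold functional of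
[Balaban1987RG1] on the local minimiser background (`Node00.chiOfRecord` on `ukBox`) and the first-form thresholds on
`∂U_k(V)` are analytic in the field ONLY on the (open) small-field domain, not on an entire ambient space, so the
global engine does not reach them; with this file their `dU`-nullity needs only «the functional is real-analytic on
the small-field domain» — N07's ∕ (F1)'s content, NOT claimed here.

CITATION HEADER.  [BrockerTomDieck1985] Th. Bröcker, T. tom Dieck, *Representations of Compact Lie Groups*, GTM 98
(1985), Ch. IV **Thm. (2.11)** and its printed proof (quoted above) — here chart by chart, WITHOUT a global
non-vanishing hypothesis.  [Mityagin2015] B. S. Mityagin, Math. Notes **107** (2020) 529–530 ∕ arXiv:1512.07276,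
**Prop. 1** *«Let A(x) be a real analytic function on a connected open domain U of ℝ^d. If A is not identically zero,
then its zero set … has zero measure»* — PROVED in the tree for every finite-dimensional real normed space and every
additive Haar measure (`Literature.Analysis.Calculus.addHaar_zeroSet_eq_zero_of_analyticOnNhd_complex`, open CONNECTED
`U`), applied on the chart BALLS `B(0,s) ⊆ 𝐠`.  [Helgason2000] Ch. I §1 Thm. 1.14 (13) p. 96 — Haar measure in
exponential coordinates = p28's `IsChartRep.lintegral_haar_window_eq` BY NAME.

WHAT IS PROVED (theorems only; 0 definitions, 0 named facts, 0 sorry; axioms standard).  SETTING (p28's verbatim): `𝔸`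
a complete normed `ℂ`-algebra, `G` a compact topological group, `h : IsChartRep C ρ` (`ρ : G →* 𝔸` faithful,
continuous, onto the carrier of a log-chart `C`; `𝐠 = C.lie` finite-dimensional, `ad`-stable (`hlie`)), `Θ = h.expChart`,
windows `V_s = Θ(B(0,s))`, `s_C = chartRadius C`; `μ` ANY Haar measure on `G`; `W ⊆ 𝔸` OPEN, `f : 𝔸 → ℂ` with
`AnalyticOnNhd ℝ f W`.  TRACE ZERO SET `Z = {g : ρ g ∈ W ∧ f(ρ g) = 0}`; «`g` flat» = `∀ᶠ g' in 𝓝 g, f(ρ g') = 0`.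
* §1 LOCAL WINDOWS — `analyticOnNhd_translate_on` (`X ↦ f(k·e^X)` on the open `{X : k·e^X ∈ W}`),
  `continuous_translate`, `isOpen_setOf_translate_mem`, `exists_radius_translate_subset` (`k ∈ W ⇒ ∃ s ∈ ]0, s_C]`,
  `k·e^{B(0,s)} ⊆ W`), ★ `addHaar_setOf_translate_eq_zero_of_ball` (Mityagin on the ball), `measurableSet_traceZeroSet`,
  ★★ `haar_traceZeroSet_inter_translate_window_eq_zero` (p28's one-window lemma with `W`: `μ(Z ∩ k·V_s) = 0`).
* §2 THE FLAT LOCUS — ★★★ `haar_traceZeroSet_diff_flat_eq_zero`: `μ{g ∈ Z : ¬(g flat)} = 0`, NO surjectivity of `Θ`,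
  NO connectedness (`measure_null_of_locally_null` over translated windows); `ae_eventually_eq_zero_of_eq_zero`.
* §3 IDENTITY THEOREM ALONG `G` + PRECONNECTED FORM — ★ `eqOn_zero_translate_window_of_flat` (one flat point in a
  translated window `k·V_s ⊆ W` ⇒ `f ∘ ρ ≡ 0` on `k·V_s`; Mathlib's
  `AnalyticOnNhd.eqOn_zero_of_preconnected_of_eventuallyEq_zero` on the ball), `flat_of_mem_closure_flat` (the flat
  locus is relatively closed in `G ∩ W`), ★★★ `haar_zeroSet_eq_zero_of_isPreconnected_of_not_flat` ∕
  ★★★ `haar_zeroSet_eq_zero_of_isPreconnected` (`S ⊆ G` preconnected, `ρ(S) ⊆ W`, ONE non-flat point ∕ ONE `g₀ ∈ S`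
  with `f(ρ g₀) ≠ 0` ⇒ `μ{g ∈ S : f(ρ g) = 0} = 0`), `haar_traceZeroSet_eq_zero_of_isPreconnected`,
  `ae_ne_zero_of_isPreconnected`.

HONEST SCOPE.  (i) p28's global theorem (`W = univ`, `Θ` onto) is NOT restated; it is the case `S = univ` of §3.
(ii) The flat locus is genuinely needed: on a disconnected trace `G ∩ W` a function may vanish identically on one
piece.  (iii) INSTANCES at the lineage's types (closed `Gs ≤ U(N)` via `isChartRep_unitarySubgroup`, `U(N)`, `SU(N)` via
p28's `isChartRep_unitaryGroup` ∕ `isChartRep_specialUnitaryGroup` — one `exact` each) and finite PRODUCTS (`Measure.pi`,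
`Setup.fieldMeasure`) are the sibling modules `HaarAnalyticZeroSetNullLocalPi` ∕ `…LocalGroups` (this seat), not here.  (iv) Nothing of p28's files, of `RealAnalyticZeroSetAddHaar` or of Mathlib is
re-proved.  (v) No claim about Bałaban's renormalization group: no threshold functional, minimiser or fibre map is
constructed; `hreg`∕`contTOn` stay displayed; N09 is NOT discharged; nothing continuum ∕ OS ∕ mass gap ∕ Clay.
-/
noncomputable section

open NormedSpace Set Function Filter Topology MeasureTheory
open scoped ENNReal NNReal

namespace Literature.MathematicalPhysics.QuantumFieldTheory.Balaban1983to89.HaarAnalyticZeroSetNullLocal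

open HaarExponentialChart HaarExponentialChart.IsChartRep
open Literature.Analysis.Calculus (addHaar_zeroSet_eq_zero_of_analyticOnNhd_complex)

/-! ## §1 Local windows: translated exponential charts inside `W` and Mityagin on the ball -/

section Generic

variable {𝔸 : Type*} [NormedRing 𝔸] [NormedAlgebra ℂ 𝔸] [CompleteSpace 𝔸]
variable {G : Type*} [Group G] [TopologicalSpace G] [IsTopologicalGroup G] [CompactSpace G]
variable {C : LogChart 𝔸} {ρ : G →* 𝔸} [FiniteDimensional ℝ C.lie]
variable {W : Set 𝔸} {f : 𝔸 → ℂ}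

omit [CompactSpace G] [FiniteDimensional ℝ C.lie] in
/-- `X ↦ f(k·e^X)` is real-analytic on the open set `{X ∈ 𝐠 : k·e^X ∈ W}` whenever `f` is real-analytic on `W`.
[cite: Mityagin2015, Proposition 1] -/
theorem analyticOnNhd_translate_on (hf : AnalyticOnNhd ℝ f W) (k : 𝔸) :
    AnalyticOnNhd ℝ (fun X : C.lie => f (k * exp (X : 𝔸))) {X : C.lie | k * exp (X : 𝔸) ∈ W} := by
  intro X hX
  have h1 : AnalyticAt ℝ (fun Y : C.lie => (Y : 𝔸)) X := (C.lie.subtypeL).analyticAt X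
  have h2 : AnalyticAt ℝ (fun Y : 𝔸 => k * exp Y) (X : 𝔸) :=
    analyticAt_const.mul (NormedSpace.exp_analytic (X : 𝔸))
  have h3 : AnalyticAt ℝ (fun Y : C.lie => k * exp (Y : 𝔸)) X := h2.comp h1
  refine (hf _ ?_).comp h3
  exact hX

omit [CompactSpace G] [FiniteDimensional ℝ C.lie] in
/-- `X ↦ k·e^X` is continuous on `𝐠` (translated exponential chart read in `𝔸`).
[cite: Helgason2000, Ch. I §1 Thm. 1.14 (13) p. 96] -/
theorem continuous_translate (k : 𝔸) : Continuous (fun X : C.lie => k * exp (X : 𝔸)) := by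
  letI : NormedAlgebra ℚ 𝔸 := NormedAlgebra.restrictScalars ℚ ℂ 𝔸
  exact continuous_const.mul (exp_continuous.comp continuous_subtype_val)

omit [CompactSpace G] [FiniteDimensional ℝ C.lie] in
/-- `{X ∈ 𝐠 : k·e^X ∈ W}` is open for open `W`. [cite: Helgason2000, Ch. I §1 Thm. 1.14 (13) p. 96] -/
theorem isOpen_setOf_translate_mem (hW : IsOpen W) (k : 𝔸) : IsOpen {X : C.lie | k * exp (X : 𝔸) ∈ W} :=
  hW.preimage (continuous_translate (C := C) k)

omit [CompactSpace G] [FiniteDimensional ℝ C.lie] in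
/-- For `k ∈ W` open there is a chart radius `0 < s ≤ s_C` with `k·e^{B(0,s)} ⊆ W` (a canonical coordinate
neighbourhood of `k` inside `W`). [cite: Helgason2000, Ch. I §1 Thm. 1.14 (13) p. 96] -/
theorem exists_radius_translate_subset (hW : IsOpen W) {k : 𝔸} (hk : k ∈ W) :
    ∃ s : ℝ, 0 < s ∧ s ≤ chartRadius C ∧ ∀ X : C.lie, ‖X‖ < s → k * exp (X : 𝔸) ∈ W := by
  have h0 : (0 : C.lie) ∈ {X : C.lie | k * exp (X : 𝔸) ∈ W} := by
    simp only [mem_setOf_eq, Submodule.coe_zero, exp_zero, mul_one]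
    exact hk
  obtain ⟨r, hr, hball⟩ := Metric.isOpen_iff.1 (isOpen_setOf_translate_mem (C := C) hW k) 0 h0
  refine ⟨min r (chartRadius C), lt_min hr chartRadius_pos, min_le_right _ _, fun X hX => ?_⟩
  exact hball (mem_ball_zero_iff.2 (lt_of_lt_of_le hX (min_le_left _ _)))

omit [CompactSpace G] in
/-- **MITYAGIN ON THE BALL**: for every additive Haar `η` on `𝐠`, every `k` with `k·e^{B(0,s)} ⊆ W` and one
`X₀ ∈ B(0,s)` with `f(k e^{X₀}) ≠ 0`: `η{X ∈ B(0,s) : f(k·e^X) = 0} = 0` (the ball is open and connected).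
[cite: Mityagin2015, Proposition 1] [cite: BrockerTomDieck1985, IV (2.11) (proof)] -/
theorem addHaar_setOf_translate_eq_zero_of_ball [MeasurableSpace C.lie] [BorelSpace C.lie]
    (η : Measure C.lie) [η.IsAddHaarMeasure] (hf : AnalyticOnNhd ℝ f W) (k : 𝔸) {s : ℝ}
    (hsub : ∀ X : C.lie, ‖X‖ < s → k * exp (X : 𝔸) ∈ W)
    (hne : ∃ X₀ : C.lie, ‖X₀‖ < s ∧ f (k * exp (X₀ : 𝔸)) ≠ 0) :
    η {X ∈ Metric.ball (0 : C.lie) s | f (k * exp (X : 𝔸)) = 0} = 0 := by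
  obtain ⟨X₀, hX₀, hfX₀⟩ := hne
  have hball : IsConnected (Metric.ball (0 : C.lie) s) :=
    ⟨⟨X₀, mem_ball_zero_iff.2 hX₀⟩, (convex_ball (0 : C.lie) s).isPreconnected⟩
  have han : AnalyticOnNhd ℝ (fun X : C.lie => f (k * exp (X : 𝔸))) (Metric.ball (0 : C.lie) s) :=
    (analyticOnNhd_translate_on (C := C) hf k).mono fun X hX => hsub X (mem_ball_zero_iff.1 hX)
  exact addHaar_zeroSet_eq_zero_of_analyticOnNhd_complex η Metric.isOpen_ball hball han
    ⟨X₀, mem_ball_zero_iff.2 hX₀, hfX₀⟩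

variable [MeasurableSpace G] [BorelSpace G]

omit [CompleteSpace 𝔸] [IsTopologicalGroup G] [CompactSpace G] [FiniteDimensional ℝ C.lie] in
/-- The trace zero set `{g : ρ g ∈ W ∧ f(ρ g) = 0}` is Borel (open minus relatively open).
[cite: BrockerTomDieck1985, IV (2.11) (proof)] -/
theorem measurableSet_traceZeroSet (h : IsChartRep C ρ) (hW : IsOpen W) (hf : AnalyticOnNhd ℝ f W) :
    MeasurableSet {g : G | ρ g ∈ W ∧ f (ρ g) = 0} := by
  have hO : IsOpen (ρ ⁻¹' W) := hW.preimage h.continuous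
  have hcont : ContinuousOn (fun g : G => f (ρ g)) (ρ ⁻¹' W) :=
    hf.continuousOn.comp h.continuous.continuousOn fun g hg => hg
  have hO' : IsOpen (ρ ⁻¹' W ∩ (fun g : G => f (ρ g)) ⁻¹' {z : ℂ | z ≠ 0}) :=
    hcont.isOpen_inter_preimage hO isOpen_ne
  have hset : {g : G | ρ g ∈ W ∧ f (ρ g) = 0} =
      ρ ⁻¹' W \ (ρ ⁻¹' W ∩ (fun g : G => f (ρ g)) ⁻¹' {z : ℂ | z ≠ 0}) := by
    ext g
    simp only [mem_setOf_eq, Set.mem_sdiff, mem_inter_iff, mem_preimage, not_and, not_not]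
    constructor
    · rintro ⟨hgW, hfg⟩
      exact ⟨hgW, fun _ => hfg⟩
    · rintro ⟨hgW, himp⟩
      exact ⟨hgW, himp hgW⟩
  rw [hset]
  exact hO.measurableSet.diff hO'.measurableSet

variable (μ : Measure G) [μ.IsHaarMeasure]

/-- **ONE TRANSLATED WINDOW, LOCAL FORM**: for `0 < s ≤ s_C` and `k ∈ G` with `ρ(k)·e^{B(0,s)} ⊆ W` and
`f(ρ(k) e^{X₀}) ≠ 0` for one `X₀ ∈ B(0,s)`, `μ({g : ρ g ∈ W ∧ f(ρ g) = 0} ∩ k·V_s) = 0` (left invariance, p28's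
window formula with `F = 𝟙[k⁻¹-translate of the zero set]`, §1 Mityagin on the ball).
[cite: Helgason2000, Ch. I §1 Thm. 1.14 (13) p. 96] [cite: BrockerTomDieck1985, IV (2.11) (proof)]
[cite: Mityagin2015, Proposition 1] -/
theorem haar_traceZeroSet_inter_translate_window_eq_zero (h : IsChartRep C ρ)
    (hlie : ∀ x ∈ C.lie, ∀ y ∈ C.lie, x * y - y * x ∈ C.lie) (hW : IsOpen W)
    (hf : AnalyticOnNhd ℝ f W) {s : ℝ} (hs0 : 0 < s) (hs : s ≤ chartRadius C) (k : G)
    (hsub : ∀ X : C.lie, ‖X‖ < s → ρ k * exp (X : 𝔸) ∈ W)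
    (hne : ∃ X₀ : C.lie, ‖X₀‖ < s ∧ f (ρ k * exp (X₀ : 𝔸)) ≠ 0) :
    μ ({g : G | ρ g ∈ W ∧ f (ρ g) = 0} ∩ {g : G | k⁻¹ * g ∈ h.window s}) = 0 := by
  classical
  haveI := h.secondCountableTopology
  borelize ↥C.lie
  let η : Measure C.lie := Measure.addHaar
  set Z : Set G := {g : G | ρ g ∈ W ∧ f (ρ g) = 0} with hZ
  have hZm : MeasurableSet Z := measurableSet_traceZeroSet h hW hf
  set V : Set G := (fun g => k * g) ⁻¹' Z ∩ h.window s with hV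
  have hpre : Z ∩ {g : G | k⁻¹ * g ∈ h.window s} = (fun g => k⁻¹ * g) ⁻¹' V := by
    ext g
    simp only [V, Set.mem_inter_iff, Set.mem_setOf_eq, Set.mem_preimage, mul_inv_cancel_left]
  have hPm : MeasurableSet ((fun g => k * g) ⁻¹' Z) := hZm.preimage (measurable_const_mul k)
  rw [hpre, measure_preimage_mul]
  have hF : Measurable (((fun g => k * g) ⁻¹' Z).indicator (1 : G → ℝ≥0∞)) := measurable_one.indicator hPm
  have hVeq : ∫⁻ g in h.window s, ((fun g => k * g) ⁻¹' Z).indicator 1 g ∂μ = μ V := by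
    rw [lintegral_indicator_one hPm, Measure.restrict_apply hPm]
  rw [← hVeq, h.lintegral_haar_window_eq hlie η μ hs0 hs hF]
  -- the chart-side zero set on the ball is `η`-null
  set Zc : Set C.lie := {X ∈ Metric.ball (0 : C.lie) s | f (ρ k * exp (X : 𝔸)) = 0} with hZc
  have hZc0 : η Zc = 0 := addHaar_setOf_translate_eq_zero_of_ball (C := C) η hf (ρ k) hsub hne
  have hint : ∫⁻ X in Metric.ball 0 s, ((fun g => k * g) ⁻¹' Z).indicator 1 (h.expChart X) *
      jacDensity hlie X ∂η = 0 := by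
    refine le_antisymm ?_ bot_le
    calc ∫⁻ X in Metric.ball 0 s, ((fun g => k * g) ⁻¹' Z).indicator 1 (h.expChart X) * jacDensity hlie X ∂η
        ≤ ∫⁻ X in Metric.ball 0 s, Zc.indicator (jacDensity hlie) X ∂η := by
          refine lintegral_mono_ae ?_
          filter_upwards [ae_restrict_mem measurableSet_ball] with X hX
          by_cases hXZ : h.expChart X ∈ (fun g => k * g) ⁻¹' Z
          · have hXZc : X ∈ Zc := by
              refine ⟨hX, ?_⟩
              have hXZ' : ρ (k * h.expChart X) ∈ W ∧ f (ρ (k * h.expChart X)) = 0 := hXZ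
              rw [map_mul, h.rho_expChart] at hXZ'
              exact hXZ'.2
            rw [Set.indicator_of_mem hXZ, Set.indicator_of_mem hXZc, Pi.one_apply, one_mul]
          · rw [Set.indicator_of_notMem hXZ, zero_mul]
            exact bot_le
      _ ≤ ∫⁻ X, Zc.indicator (jacDensity hlie) X ∂η := setLIntegral_le_lintegral _ _
      _ ≤ ∫⁻ X in Zc, jacDensity hlie X ∂η := lintegral_indicator_le _ _
      _ = 0 := by rw [Measure.restrict_eq_zero.2 hZc0, lintegral_zero_measure]
  rw [hint, mul_zero]

/-! ## §2 The flat locus: the zero set on `G ∩ W` is null up to the points where `f ∘ ρ` vanishes locally -/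

/-- ★★★ **THE ZERO SET IS NULL UP TO ITS FLAT LOCUS** — for EVERY compact chart-represented `G`, every Haar `μ`, every
open `W ⊆ 𝔸` and every `f` real-analytic on `W` only:
`μ{g : ρ g ∈ W ∧ f(ρ g) = 0 ∧ ¬(f ∘ ρ vanishes on a neighbourhood of g)} = 0`.  No surjectivity of the exponential
chart and no connectedness are assumed: each non-flat zero `g` has the translated window `g·V_s ⊆ W` as a
neighbourhood on which the zero set is null (§1), and `G` is second countable (`measure_null_of_locally_null`).
[cite: BrockerTomDieck1985, IV (2.11) (proof)] [cite: Mityagin2015, Proposition 1]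
[cite: Helgason2000, Ch. I §1 Thm. 1.14 (13) p. 96] -/
theorem haar_traceZeroSet_diff_flat_eq_zero (h : IsChartRep C ρ)
    (hlie : ∀ x ∈ C.lie, ∀ y ∈ C.lie, x * y - y * x ∈ C.lie) (hW : IsOpen W)
    (hf : AnalyticOnNhd ℝ f W) :
    μ {g : G | ρ g ∈ W ∧ f (ρ g) = 0 ∧ ¬ ∀ᶠ g' in 𝓝 g, f (ρ g') = 0} = 0 := by
  haveI := h.secondCountableTopology
  refine measure_null_of_locally_null _ fun g hg => ?_
  obtain ⟨hgW, -, hnf⟩ := hg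
  obtain ⟨s, hs0, hs, hsub⟩ := exists_radius_translate_subset (C := C) hW hgW
  -- the translated window around `g`
  set T : Set G := {g' : G | g⁻¹ * g' ∈ h.window s} with hT
  have hTo : IsOpen T := (h.isOpen_window hs).preimage (continuous_const.mul continuous_id)
  have hgT : g ∈ T := by
    show g⁻¹ * g ∈ h.window s
    rw [inv_mul_cancel]
    exact h.one_mem_window hs0
  have hTn : T ∈ 𝓝 g := hTo.mem_nhds hgT
  -- a non-vanishing point of `f` in the translated window (otherwise `g` would be flat)
  have hne : ∃ X₀ : C.lie, ‖X₀‖ < s ∧ f (ρ g * exp (X₀ : 𝔸)) ≠ 0 := by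
    by_contra hcon
    push Not at hcon
    apply hnf
    filter_upwards [hTn] with g' hg'
    have hg'' : g⁻¹ * g' ∈ h.expChart '' Metric.ball 0 s := hg'
    obtain ⟨X, hX, hXe⟩ := hg''
    have hρ : ρ g' = ρ g * exp (X : 𝔸) := by
      have h1 : g * h.expChart X = g' := by rw [hXe, mul_inv_cancel_left]
      rw [← h1, map_mul, h.rho_expChart]
    rw [hρ]
    exact hcon X (mem_ball_zero_iff.1 hX)
  refine ⟨T ∩ {g' : G | ρ g' ∈ W ∧ f (ρ g') = 0 ∧ ¬ ∀ᶠ g'' in 𝓝 g', f (ρ g'') = 0},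
    inter_mem (mem_nhdsWithin_of_mem_nhds hTn) self_mem_nhdsWithin, ?_⟩
  refine measure_mono_null ?_ (haar_traceZeroSet_inter_translate_window_eq_zero μ h hlie hW hf hs0 hs g hsub hne)
  intro g' hg'
  exact ⟨⟨hg'.2.1, hg'.2.2.1⟩, hg'.1⟩

/-- Almost-everywhere form of §2: for `μ`-a.e. `g ∈ G`, if `ρ g ∈ W` and `f(ρ g) = 0` then `f ∘ ρ` vanishes on a whole
neighbourhood of `g`. [cite: BrockerTomDieck1985, IV (2.11) (proof)] [cite: Mityagin2015, Proposition 1] -/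
theorem ae_eventually_eq_zero_of_eq_zero (h : IsChartRep C ρ)
    (hlie : ∀ x ∈ C.lie, ∀ y ∈ C.lie, x * y - y * x ∈ C.lie) (hW : IsOpen W)
    (hf : AnalyticOnNhd ℝ f W) :
    ∀ᵐ g ∂μ, ρ g ∈ W → f (ρ g) = 0 → ∀ᶠ g' in 𝓝 g, f (ρ g') = 0 := by
  rw [ae_iff]
  refine measure_mono_null (fun g hg => ?_) (haar_traceZeroSet_diff_flat_eq_zero μ h hlie hW hf)
  simp only [mem_setOf_eq, Classical.not_imp] at hg
  exact ⟨hg.1, hg.2.1, hg.2.2⟩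

/-! ## §3 The identity theorem along `G` and the preconnected form -/

omit [FiniteDimensional ℝ C.lie] [MeasurableSpace G] [BorelSpace G] in
/-- ★ **ONE FLAT POINT FLATTENS THE WHOLE TRANSLATED WINDOW**: if `ρ(g)·e^{B(0,s)} ⊆ W` (`s ≤ s_C`) and `f ∘ ρ`
vanishes on a neighbourhood of ONE point `g₁ ∈ g·V_s`, then `f ∘ ρ ≡ 0` on `g·V_s` (the chart-side function
`X ↦ f(ρ(g) e^X)` is real-analytic on the preconnected ball `B(0,s)` and vanishes near `Λ(g⁻¹g₁)`: Mathlib's identity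
theorem `AnalyticOnNhd.eqOn_zero_of_preconnected_of_eventuallyEq_zero`). [cite: Mityagin2015, Proposition 1]
[cite: BrockerTomDieck1985, IV (2.11) (proof)] -/
theorem eqOn_zero_translate_window_of_flat (h : IsChartRep C ρ) (hf : AnalyticOnNhd ℝ f W) {s : ℝ} (g : G)
    (hsub : ∀ X : C.lie, ‖X‖ < s → ρ g * exp (X : 𝔸) ∈ W)
    {g₁ : G} (hg₁ : g⁻¹ * g₁ ∈ h.window s) (hflat : ∀ᶠ g' in 𝓝 g₁, f (ρ g') = 0) :
    ∀ g' : G, g⁻¹ * g' ∈ h.window s → f (ρ g') = 0 := by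
  set F : C.lie → ℂ := fun X => f (ρ g * exp (X : 𝔸)) with hF
  have hFa : AnalyticOnNhd ℝ F (Metric.ball (0 : C.lie) s) :=
    (analyticOnNhd_translate_on (C := C) hf (ρ g)).mono fun X hX => hsub X (mem_ball_zero_iff.1 hX)
  have hg₁' : g⁻¹ * g₁ ∈ h.expChart '' Metric.ball 0 s := hg₁
  obtain ⟨X₁, hX₁, hX₁e⟩ := hg₁'
  have hcont : Continuous fun X : C.lie => g * h.expChart X := continuous_const.mul h.continuous_expChart
  have hgX₁ : g * h.expChart X₁ = g₁ := by rw [hX₁e, mul_inv_cancel_left]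
  have hFX₁ : F =ᶠ[𝓝 X₁] 0 := by
    have ht : Tendsto (fun X : C.lie => g * h.expChart X) (𝓝 X₁) (𝓝 g₁) := by
      rw [← hgX₁]
      exact hcont.continuousAt
    filter_upwards [ht.eventually hflat] with X hX
    have hX' : f (ρ g * exp (X : 𝔸)) = 0 := by rwa [map_mul, h.rho_expChart] at hX
    exact hX'
  have hF0 : EqOn F 0 (Metric.ball (0 : C.lie) s) :=
    hFa.eqOn_zero_of_preconnected_of_eventuallyEq_zero (convex_ball (0 : C.lie) s).isPreconnected hX₁ hFX₁
  intro g' hg'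
  have hg'' : g⁻¹ * g' ∈ h.expChart '' Metric.ball 0 s := hg'
  obtain ⟨X, hX, hXe⟩ := hg''
  have hgX : ρ g' = ρ g * exp (X : 𝔸) := by
    have h1 : g * h.expChart X = g' := by rw [hXe, mul_inv_cancel_left]
    rw [← h1, map_mul, h.rho_expChart]
  rw [hgX]
  exact hF0 hX

omit [FiniteDimensional ℝ C.lie] [MeasurableSpace G] [BorelSpace G] in
/-- **THE FLAT LOCUS IS RELATIVELY CLOSED IN `G ∩ W`**: a point `g` with `ρ g ∈ W` in the closure of the flat locus is
flat (a translated window `g·V_s ⊆ W` meets the flat locus, §3 flattens it). [cite: Mityagin2015, Proposition 1]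
[cite: BrockerTomDieck1985, IV (2.11) (proof)] -/
theorem flat_of_mem_closure_flat (h : IsChartRep C ρ) (hW : IsOpen W) (hf : AnalyticOnNhd ℝ f W) {g : G}
    (hgW : ρ g ∈ W)
    (hg : g ∈ closure {g' : G | ∀ᶠ g'' in 𝓝 g', f (ρ g'') = 0}) : ∀ᶠ g' in 𝓝 g, f (ρ g') = 0 := by
  obtain ⟨s, hs0, hs, hsub⟩ := exists_radius_translate_subset (C := C) hW hgW
  set T : Set G := {g' : G | g⁻¹ * g' ∈ h.window s} with hT
  have hTo : IsOpen T := (h.isOpen_window hs).preimage (continuous_const.mul continuous_id)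
  have hgT : g ∈ T := by
    show g⁻¹ * g ∈ h.window s
    rw [inv_mul_cancel]
    exact h.one_mem_window hs0
  obtain ⟨g₁, hg₁T, hg₁flat⟩ := mem_closure_iff_nhds.1 hg T (hTo.mem_nhds hgT)
  have hall := eqOn_zero_translate_window_of_flat h hf g hsub hg₁T hg₁flat
  exact Filter.mem_of_superset (hTo.mem_nhds hgT) fun g' hg' => hall g' hg'

/-- ★★★ **PRECONNECTED FORM, NON-FLAT WITNESS**: if `S ⊆ G` is preconnected, `ρ(S) ⊆ W`, and at ONE point of `S` the
function `f ∘ ρ` does not vanish identically nearby, then `μ{g ∈ S : f(ρ g) = 0} = 0` (the flat locus is open and,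
by §3, relatively closed in `G ∩ W ⊇ S`; it misses one point of `S`, hence all of `S`
(`IsPreconnected.subset_of_closure_inter_subset`); §2 concludes). [cite: BrockerTomDieck1985, IV (2.11) (proof)]
[cite: Mityagin2015, Proposition 1] [cite: Helgason2000, Ch. I §1 Thm. 1.14 (13) p. 96] -/
theorem haar_zeroSet_eq_zero_of_isPreconnected_of_not_flat (h : IsChartRep C ρ)
    (hlie : ∀ x ∈ C.lie, ∀ y ∈ C.lie, x * y - y * x ∈ C.lie) 
    (hW : IsOpen W) (hf : AnalyticOnNhd ℝ f W) {S : Set G} (hS : IsPreconnected S) (hSW : ∀ g ∈ S, ρ g ∈ W)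
    (hne : ∃ g₀ ∈ S, ¬ ∀ᶠ g' in 𝓝 g₀, f (ρ g') = 0) :
    μ {g ∈ S | f (ρ g) = 0} = 0 := by
  set Fl : Set G := {g' : G | ∀ᶠ g'' in 𝓝 g', f (ρ g'') = 0} with hFl
  have hFlo : IsOpen Fl := isOpen_setOf_eventually_nhds
  -- `S` misses the flat locus
  have hSFl : ∀ g ∈ S, g ∉ Fl := by
    intro g hgS hgFl
    have hsub : S ⊆ Fl := hS.subset_of_closure_inter_subset hFlo ⟨g, hgS, hgFl⟩
      fun g' hg' => flat_of_mem_closure_flat h hW hf (hSW g' hg'.2) hg'.1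
    obtain ⟨g₀, hg₀S, hg₀⟩ := hne
    exact hg₀ (hsub hg₀S)
  refine measure_mono_null (fun g hg => ?_) (haar_traceZeroSet_diff_flat_eq_zero μ h hlie hW hf)
  exact ⟨hSW g hg.1, hg.2, hSFl g hg.1⟩

/-- ★★★ **PRECONNECTED FORM**: if `S ⊆ G` is preconnected, `ρ(S) ⊆ W`, and `f(ρ g₀) ≠ 0` for ONE `g₀ ∈ S`, then
`μ{g ∈ S : f(ρ g) = 0} = 0` — p28's `HaarAnalyticZeroSetNull.haar_zeroSet_eq_zero` is the case `W = univ`, `S = G`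
(connected as `Θ(𝐠)` when `Θ` is onto). [cite: BrockerTomDieck1985, IV (2.11) (proof)]
[cite: Mityagin2015, Proposition 1] [cite: Helgason2000, Ch. I §1 Thm. 1.14 (13) p. 96] -/
theorem haar_zeroSet_eq_zero_of_isPreconnected (h : IsChartRep C ρ)
    (hlie : ∀ x ∈ C.lie, ∀ y ∈ C.lie, x * y - y * x ∈ C.lie) 
    (hW : IsOpen W) (hf : AnalyticOnNhd ℝ f W) {S : Set G} (hS : IsPreconnected S) (hSW : ∀ g ∈ S, ρ g ∈ W) (hne : ∃ g₀ ∈ S, f (ρ g₀) ≠ 0) :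
    μ {g ∈ S | f (ρ g) = 0} = 0 := by
  obtain ⟨g₀, hg₀S, hg₀⟩ := hne
  exact haar_zeroSet_eq_zero_of_isPreconnected_of_not_flat μ h hlie hW hf hS hSW
    ⟨g₀, hg₀S, fun hflat => hg₀ hflat.self_of_nhds⟩

/-- The whole trace: if `{g : ρ g ∈ W}` is preconnected and carries one non-zero of `f`, then
`μ{g : ρ g ∈ W ∧ f(ρ g) = 0} = 0`. [cite: BrockerTomDieck1985, IV (2.11) (proof)] [cite: Mityagin2015, Proposition 1] -/
theorem haar_traceZeroSet_eq_zero_of_isPreconnected (h : IsChartRep C ρ)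
    (hlie : ∀ x ∈ C.lie, ∀ y ∈ C.lie, x * y - y * x ∈ C.lie) 
    (hW : IsOpen W) (hf : AnalyticOnNhd ℝ f W) (hS : IsPreconnected {g : G | ρ g ∈ W}) (hne : ∃ g₀ : G, ρ g₀ ∈ W ∧ f (ρ g₀) ≠ 0) :
    μ {g : G | ρ g ∈ W ∧ f (ρ g) = 0} = 0 := by
  obtain ⟨g₀, hg₀W, hg₀⟩ := hne
  exact haar_zeroSet_eq_zero_of_isPreconnected μ h hlie hW hf hS (fun g hg => hg) ⟨g₀, hg₀W, hg₀⟩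

/-- Almost-everywhere form of the preconnected theorem: `μ`-a.e. `g ∈ S` has `f(ρ g) ≠ 0`.
[cite: BrockerTomDieck1985, IV (2.11) (proof)] [cite: Mityagin2015, Proposition 1] -/
theorem ae_ne_zero_of_isPreconnected (h : IsChartRep C ρ)
    (hlie : ∀ x ∈ C.lie, ∀ y ∈ C.lie, x * y - y * x ∈ C.lie) 
    (hW : IsOpen W) (hf : AnalyticOnNhd ℝ f W) {S : Set G} (hS : IsPreconnected S) (hSW : ∀ g ∈ S, ρ g ∈ W) (hne : ∃ g₀ ∈ S, f (ρ g₀) ≠ 0) :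
    ∀ᵐ g ∂μ, g ∈ S → f (ρ g) ≠ 0 := by
  rw [ae_iff]
  refine measure_mono_null (fun g hg => ?_) (haar_zeroSet_eq_zero_of_isPreconnected μ h hlie hW hf hS hSW hne)
  simp only [mem_setOf_eq, Classical.not_imp, not_not] at hg
  exact hg

end Generic

end Literature.MathematicalPhysics.QuantumFieldTheory.Balaban1983to89.HaarAnalyticZeroSetNullLocal

end
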